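import Summits.NavierStokesRegularity.NavierStokesRegularity.Theorems.StrainDoorsFineStructure
import Literature.Analysis.FluidPDE.CommutatorCZTransfer
import HarnessLib

/-!
# StrainDoorsQuadrupole — the deviatoric near term in DIFFERENCE form, the FLATNESS PLATE, and door D9

nsreg-p1 g34 ROUND-47 (cell ns-regularity-ideate, rung N0, helper lane of `stmt-NavierStokesRegularity-0056`;
`--supports 0056 --as helper`).  Everything here is PROVED (std axioms); the only open input of the D8/D8′/D9 family stays
the NS-free atom `HessSmoothingEnergyBound` (B3) of `StrainDoorsLocalNewton`.

§15 DIFFERENCE FORM (kernel-checked).  In the door frame (`q = ½|ω|² − |S|² = qDensity`, `C^∞` in space because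
`q = Δp`), the trace-free near term of door D8′ is a CONVERGENT singular integral on DIFFERENCES plus a shell term:
  `TF_ee(x) = ∫ K_ee(x − y) (q(y) − q(x)) dy + ⅓ ∫ λ(z) (q(x − z) − q(x)) dz`          (`tfNearHess_eq_integral_sub`)
with `K_ee = newtonNearHess r₀ r₁ e e = ∂ₑ∂ₑ(θΓ)` (supported in `|z| ≤ r₁`, `|K_ee(z)| ≤ A|z|⁻³`) and `λ = newtonFarLaplacian`
(unit mass, supported in `r₀ ≤ |z| ≤ r₁`).  Inside the inner radius `K_ee` IS the quadrupole kernel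
`(|z|² − 3⟨z,e⟩²)/(4π|z|⁵) = −P₂(cos∠(z,e))/(2π|z|³)` (`newtonNearHess_self_eq_quadrupole`), so `TF_ee(x)` measures the
QUADRUPOLAR ANISOTROPY of `q` around the maximiser, seen only through the increments `q(y) − q(x)`, `|y − x| ≤ r₁`.
Proof: localise `q` by the smooth cutoff `θ_{r₁+1,r₁+2}(· − x)` (`qLoc`: `C²`, compact support, hence Hölder), apply the
tree's Calderón–Zygmund transfer `czDiff_newtonNearHess_eq_newtonNearPotential` to the localised density, and undo the
localisation pointwise under the integral (the kernels vanish where `q̃ ≠ q`); the shell term is `ΔN[q] = q − Λ[q]`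
(tree `laplacian_newtonNearPotential`) with `∫ λ = 1` (tree `integral_newtonFarLaplacian`).

§16 FLATNESS PLATE T1 (PROVED).  If `q(t,·)` is `(γ, M)`-flat at `x` at scale `r₁` — `|q(y) − q(x)| ≤ M|y − x|^γ` on the
closed ball `|y − x| ≤ r₁`, any `γ > 0` — then `|TF_ee(x)| ≤ C(r₀,r₁,γ) · M` with
`C = A·3|B₁|·r₁^γ/γ + ⅓‖λ‖₁ r₁^γ` (`exists_tfFlatnessPlate`).  No global Hölder hypothesis, no `L^p` norm: a ONE-POINT modulus.

§17 DOOR D9 «QuadrupoleFlatnessDoor».  Feeding the plate into D8′: if on `[t₀,T)` at every `δ`-almost strain maximiser above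
level `l₀` the density `q` is `(γ,M)`-flat at scale `r₁` with
  `(⅓|S|² − λ_max²) + ((1/12)|ω|² − ¼ω_e²) + ⅓Λ_{r₀r₁}[q](x) + C·M ≤ 0`,
the solution continues past `T` (`quadrupoleFlatnessDoor_of_D8'`, hence `quadrupoleFlatnessDoor_of_B3 : HessSmoothingEnergyBound →
QuadrupoleFlatnessDoor`).  This is a SINGULAR-INTEGRAL-FREE sufficient form of the D8′ hypothesis (★): the only non-local
quantity left is the unit-mass shell average `Λ[q](x)`; the price of ignoring the quadrupole term is `C·M`.
HONEST FRAME: a CONDITIONAL continuation criterion (logically downstream of D8′, same open atom B3); 0056 `NoTypeII` / 10661 /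
NS regularity NOT proved; no hard core touched.
-/

noncomputable section

open MeasureTheory Set Function Filter Metric Real InnerProductSpace intervalIntegral
open _root_.Topology
open scoped ENNReal NNReal RealInnerProductSpace ContDiff Laplacian
open Literature.Analysis Literature.Analysis.FluidPDE

set_option linter.dupNamespace false

namespace Summit.NavierStokesRegularity.NavierStokesRegularity.Theorems.StrainDoors

/-! ## §15  The deviatoric near term in DIFFERENCE form -/

/-- locality of second directional derivatives: functions agreeing near `w` have the same `∂_a∂_b` at `w`. -/
theorem fderiv_fderiv_apply_eq_of_eventuallyEq {f g : (EuclideanSpace ℝ (Fin 3)) → ℝ} {w : EuclideanSpace ℝ (Fin 3)}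
    (h : f =ᶠ[𝓝 w] g) (a b : EuclideanSpace ℝ (Fin 3)) :
    fderiv ℝ (fun y => fderiv ℝ f y a) w b = fderiv ℝ (fun y => fderiv ℝ g y a) w b := by
  have hev : (fun y => fderiv ℝ f y a) =ᶠ[𝓝 w] (fun y => fderiv ℝ g y a) := by
    filter_upwards [h.eventuallyEq_nhds] with y hy
    rw [hy.fderiv_eq]
  rw [hev.fderiv_eq]

/-- inside the inner radius the near Hessian kernel IS the quadrupole kernel:
`K_aa(z) = (|a|²|z|² − 3⟨z,a⟩²)/(4π|z|⁵)` for `0 < |z| < r₀` (for `|a| = 1`: `−P₂(cos∠(z,a))/(2π|z|³)`). -/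
theorem newtonNearHess_self_eq_quadrupole {r₀ r₁ : ℝ} (hr₀ : 0 ≤ r₀) (hr₁ : r₀ < r₁) {z : EuclideanSpace ℝ (Fin 3)}
    (hz0 : z ≠ 0) (hz : ‖z‖ < r₀) (a : EuclideanSpace ℝ (Fin 3)) :
    newtonNearHess r₀ r₁ a a z = (‖a‖ ^ 2 * ‖z‖ ^ 2 - 3 * ⟪z, a⟫ ^ 2) / (4 * π * ‖z‖ ^ 5) := by
  have hev : newtonNear r₀ r₁ =ᶠ[𝓝 z] newtonKernel := newtonNear_eventuallyEq_newtonKernel hr₀ hr₁ hz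
  have h1 : fderiv ℝ (fderiv ℝ (newtonNear r₀ r₁)) z = fderiv ℝ (fderiv ℝ newtonKernel) z := hev.fderiv.fderiv_eq
  have hd : DifferentiableAt ℝ (fderiv ℝ newtonKernel) z :=
    ((contDiffAt_newtonKernel hz0 (n := 2)).fderiv_right (m := 1) (by norm_num)).differentiableAt one_ne_zero
  have h3 : fderiv ℝ (fun w => fderiv ℝ newtonKernel w a) z a = fderiv ℝ (fderiv ℝ newtonKernel) z a a := by
    rw [fderiv_clm_apply hd (differentiableAt_const a)]
    simp
  unfold newtonNearHess
  rw [h1, ← h3, fderiv_fderiv_newtonKernel_apply hz0, real_inner_self_eq_norm_sq]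
  ring

/-- the LOCALISED density `q̃ = θ_{r₁+1,r₁+2}(· − x) · q(t,·)`: `C²` with compact support, and `= q(t,·)` on `B(x, r₁+1)`. -/
def qLoc (r₁ : ℝ) (u : ℝ → (EuclideanSpace ℝ (Fin 3)) → (EuclideanSpace ℝ (Fin 3))) (t : ℝ)
    (x : EuclideanSpace ℝ (Fin 3)) (y : EuclideanSpace ℝ (Fin 3)) : ℝ :=
  FluidPDE.radialCutoff (r₁ + 1) (r₁ + 2) (y - x) * qDensity u t y

/-- the localised density agrees with `q` on the ball. -/
theorem qLoc_eq_of_mem_ball {r₁ : ℝ} (hr₁ : 0 ≤ r₁ + 1) {u : ℝ → (EuclideanSpace ℝ (Fin 3)) → (EuclideanSpace ℝ (Fin 3))}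
    {t : ℝ} {x y : EuclideanSpace ℝ (Fin 3)} (hy : y ∈ ball x (r₁ + 1)) : qLoc r₁ u t x y = qDensity u t y := by
  unfold qLoc
  rw [FluidPDE.radialCutoff_eq_one hr₁ (by linarith) (mem_ball_iff_norm.1 hy).le, one_mul]

/-- …hence near every point of the ball. -/
theorem qLoc_eventuallyEq {r₁ : ℝ} (hr₁ : 0 ≤ r₁ + 1) {u : ℝ → (EuclideanSpace ℝ (Fin 3)) → (EuclideanSpace ℝ (Fin 3))}
    {t : ℝ} {x w : EuclideanSpace ℝ (Fin 3)} (hw : w ∈ ball x (r₁ + 1)) : qLoc r₁ u t x =ᶠ[𝓝 w] qDensity u t := by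
  filter_upwards [isOpen_ball.mem_nhds hw] with y hy
  exact qLoc_eq_of_mem_ball hr₁ hy

/-- the localised density is smooth. -/
theorem contDiff_qLoc {r₁ : ℝ} {u : ℝ → (EuclideanSpace ℝ (Fin 3)) → (EuclideanSpace ℝ (Fin 3))} {t : ℝ}
    {x : EuclideanSpace ℝ (Fin 3)} (hq : ContDiff ℝ 2 (qDensity u t)) : ContDiff ℝ 2 (qLoc r₁ u t x) := by
  unfold qLoc
  exact ((FluidPDE.radialCutoff_contDiff (E' := EuclideanSpace ℝ (Fin 3)) (r₁ + 1) (r₁ + 2) (n := 2)).comp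
    (contDiff_id.sub contDiff_const)).mul hq

/-- the localised density has compact support. -/
theorem hasCompactSupport_qLoc {r₁ : ℝ} (hr₁ : 0 ≤ r₁ + 1) {u : ℝ → (EuclideanSpace ℝ (Fin 3)) → (EuclideanSpace ℝ (Fin 3))}
    {t : ℝ} {x : EuclideanSpace ℝ (Fin 3)} : HasCompactSupport (qLoc r₁ u t x) := by
  refine HasCompactSupport.intro (isCompact_closedBall x (r₁ + 2)) fun y hy => ?_
  have hy' : r₁ + 2 ≤ ‖y - x‖ := by
    rw [mem_closedBall_iff_norm, not_le] at hy
    exact hy.le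
  unfold qLoc
  rw [FluidPDE.radialCutoff_eq_zero hr₁ (by linarith) hy', zero_mul]

/-- the localised density is Hölder (exponent ½ — any exponent in `(0,1)` would do; only used to invoke the CZ transfer). -/
theorem exists_holderWith_qLoc {r₁ : ℝ} (hr₁ : 0 ≤ r₁ + 1) {u : ℝ → (EuclideanSpace ℝ (Fin 3)) → (EuclideanSpace ℝ (Fin 3))}
    {t : ℝ} {x : EuclideanSpace ℝ (Fin 3)} (hq : ContDiff ℝ 2 (qDensity u t)) :
    ∃ C : ℝ≥0, HolderWith C (1 / 2 : ℝ≥0) (qLoc r₁ u t x) := by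
  have hc : ContDiff ℝ 2 (qLoc r₁ u t x) := contDiff_qLoc hq
  have hs : HasCompactSupport (qLoc r₁ u t x) := hasCompactSupport_qLoc hr₁
  obtain ⟨K, hK⟩ := hc.lipschitzWith_of_hasCompactSupport hs (by simp)
  obtain ⟨B, hB⟩ := hc.continuous.bounded_above_of_compact_support hs
  exact ⟨_, holderWith_of_lipschitzWith_of_norm_le (by norm_num) hK hB⟩

/-- ★ DIFFERENCE FORM of the deviatoric near term (door frame, every `t ∈ [0,T)`, `x`, `e`):
`TF_ee(x) = ∫ K_ee(x−y)(q(y) − q(x)) dy + ⅓ ∫ λ(z)(q(x−z) − q(x)) dz`. -/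
theorem tfNearHess_eq_integral_sub {ν T : ℝ} {u : ℝ → (EuclideanSpace ℝ (Fin 3)) → (EuclideanSpace ℝ (Fin 3))}
    {p : ℝ → (EuclideanSpace ℝ (Fin 3)) → ℝ} (hsol : IsClassicalNSSolutionOn (Ico 0 T) ν 0 u p) {t : ℝ} (ht : t ∈ Ico 0 T)
    {r₀ r₁ : ℝ} (hr₀ : 0 < r₀) (hr₁ : r₀ < r₁) (x e : EuclideanSpace ℝ (Fin 3)) :
    tfNearHess r₀ r₁ u t x e =
      (∫ y, newtonNearHess r₀ r₁ e e (x - y) * (qDensity u t y - qDensity u t x)) +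
        (1 / 3) * ∫ z, newtonFarLaplacian r₀ r₁ z * (qDensity u t (x - z) - qDensity u t x) := by
  have hS : UniqueDiffOn ℝ (Ico (0 : ℝ) T) := uniqueDiffOn_Ico 0 T
  have hΔs : ContDiff ℝ ∞ (fun y => (Δ (p t)) y) := (hsol.smooth_pressure.laplacian hS).contDiff_slice ht
  have hq : qDensity u t = fun y => (Δ (p t)) y := qDensity_eq_laplacian_pressure_fun hsol ht
  have hq2 : ContDiff ℝ 2 (qDensity u t) := hq ▸ contDiff_infty.1 hΔs 2
  have hqc : Continuous (qDensity u t) := hq2.continuous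
  have hr1 : 0 ≤ r₁ + 1 := by linarith
  have hG2 : ContDiff ℝ 2 (qLoc r₁ u t x) := contDiff_qLoc hq2
  obtain ⟨C', hH⟩ := exists_holderWith_qLoc (r₁ := r₁) (x := x) hr1 hq2
  -- (1) locality: `N[∂ₑ∂ₑq](x) = N[∂ₑ∂ₑq̃](x)`
  have h1 : newtonNearPotential r₀ r₁ (fun w => fderiv ℝ (fun y => fderiv ℝ (qDensity u t) y e) w e) x =
      newtonNearPotential r₀ r₁ (fun w => fderiv ℝ (fun y => fderiv ℝ (qLoc r₁ u t x) y e) w e) x := by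
    unfold newtonNearPotential
    refine integral_congr_ae (ae_of_all _ fun z => ?_)
    by_cases hz : r₁ ≤ ‖z‖
    · simp only [newtonNear_eq_zero hr₀.le hr₁ hz, zero_mul]
    · have hw : x - z ∈ ball x (r₁ + 1) := by
        rw [mem_ball_iff_norm, sub_sub_cancel_left, norm_neg]
        linarith [lt_of_not_ge hz]
      simp only [fderiv_fderiv_apply_eq_of_eventuallyEq (qLoc_eventuallyEq (u := u) (t := t) hr1 hw) e e]
  -- (2) CZ transfer on the localised density: `N[∂ₑ∂ₑq̃](x) = ∫ K_ee(x−y)(q̃(y) − q̃(x)) dy`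
  have h2 : newtonNearPotential r₀ r₁ (fun w => fderiv ℝ (fun y => fderiv ℝ (qLoc r₁ u t x) y e) w e) x =
      czDiff (newtonNearHess r₀ r₁ e e) (qLoc r₁ u t x) x :=
    (czDiff_newtonNearHess_eq_newtonNearPotential hr₀ hr₁ hG2 hH (by norm_num) (by norm_num) e e x).symm
  -- (3) undo the localisation under the integral
  have h3 : czDiff (newtonNearHess r₀ r₁ e e) (qLoc r₁ u t x) x =
      ∫ y, newtonNearHess r₀ r₁ e e (x - y) * (qDensity u t y - qDensity u t x) := by
    unfold czDiff
    refine integral_congr_ae (ae_of_all _ fun y => ?_)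
    simp only [smul_eq_mul]
    by_cases hy : r₁ ≤ ‖x - y‖
    · simp only [newtonNearHess_eq_zero_of_le hr₀ hr₁ e e hy, zero_mul]
    · have hyb : y ∈ ball x (r₁ + 1) := by
        rw [mem_ball_iff_norm, ← norm_neg, neg_sub]
        linarith [lt_of_not_ge hy]
      have hxb : x ∈ ball x (r₁ + 1) := mem_ball_self (by linarith)
      rw [qLoc_eq_of_mem_ball hr1 hyb, qLoc_eq_of_mem_ball hr1 hxb]
  -- (4) `ΔN[q](x) = q(x) − Λ[q](x)`
  have h4 : (Δ (newtonNearPotential r₀ r₁ (qDensity u t))) x =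
      qDensity u t x - newtonFarSmoothing r₀ r₁ (qDensity u t) x :=
    laplacian_newtonNearPotential hr₀ hr₁ hq2 x
  -- (5) unit mass of `λ`: `∫ λ(z)(q(x−z) − q(x)) dz = Λ[q](x) − q(x)`
  have hlamc : Continuous (newtonFarLaplacian r₀ r₁) := continuous_newtonFarLaplacian hr₀ hr₁
  have hc1 : Continuous fun z => newtonFarLaplacian r₀ r₁ z * qDensity u t (x - z) := by fun_prop
  have hint1 : Integrable fun z => newtonFarLaplacian r₀ r₁ z * qDensity u t (x - z) :=
    hc1.integrable_of_hasCompactSupport (hasCompactSupport_newtonFarLaplacian hr₀.le hr₁).mul_right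
  have hint2 : Integrable fun z => newtonFarLaplacian r₀ r₁ z * qDensity u t x :=
    (integrable_newtonFarLaplacian hr₀ hr₁).mul_const _
  have h5 : ∫ z, newtonFarLaplacian r₀ r₁ z * (qDensity u t (x - z) - qDensity u t x) =
      newtonFarSmoothing r₀ r₁ (qDensity u t) x - qDensity u t x := by
    rw [newtonFarSmoothing_apply]
    simp_rw [mul_sub]
    rw [integral_sub hint1 hint2, MeasureTheory.integral_mul_const, integral_newtonFarLaplacian hr₀ hr₁, one_mul]
  unfold tfNearHess
  rw [h1, h2, h3, h4, h5]
  ring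


/-! ## §16  The FLATNESS PLATE T1 (proved): `|TF_ee(x)| ≤ C(r₀,r₁,γ) · M` under a one-point `(γ,M)`-flatness of `q` at `x` -/

/-- one-point FLATNESS of `q = ½|ω|² − |S|²` at `x` (scale `r₁`, exponent `γ`, modulus `M`):
`|q(t,y) − q(t,x)| ≤ M |y − x|^γ` for `|y − x| ≤ r₁`. -/
def QFlatOn (γ M r₁ : ℝ) (u : ℝ → (EuclideanSpace ℝ (Fin 3)) → (EuclideanSpace ℝ (Fin 3))) (t : ℝ)
    (x : EuclideanSpace ℝ (Fin 3)) : Prop :=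
  ∀ y ∈ closedBall x r₁, |qDensity u t y - qDensity u t x| ≤ M * ‖y - x‖ ^ γ

/-- a flatness modulus at a positive scale is non-negative. -/
theorem QFlatOn.nonneg {γ M r₁ : ℝ} {u : ℝ → (EuclideanSpace ℝ (Fin 3)) → (EuclideanSpace ℝ (Fin 3))} {t : ℝ}
    {x : EuclideanSpace ℝ (Fin 3)} (h : QFlatOn γ M r₁ u t x) (hr₁ : 0 < r₁) {e : EuclideanSpace ℝ (Fin 3)}
    (he : ‖e‖ = 1) : 0 ≤ M := by
  have hn : ‖x + r₁ • e - x‖ = r₁ := by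
    rw [add_sub_cancel_left, norm_smul, Real.norm_of_nonneg hr₁.le, he, mul_one]
  have hy : x + r₁ • e ∈ closedBall x r₁ := by rw [mem_closedBall_iff_norm, hn]
  have h1 := h _ hy
  rw [hn] at h1
  have hpos : 0 < r₁ ^ γ := Real.rpow_pos_of_pos hr₁ γ
  by_contra hM
  have hneg : M * r₁ ^ γ < 0 := mul_neg_of_neg_of_pos (lt_of_not_ge hM) hpos
  linarith [abs_nonneg (qDensity u t (x + r₁ • e) - qDensity u t x)]

/-- PLATE predicate: `C` bounds the deviatoric near term by the flatness modulus, in every door frame. -/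
def TFFlatnessPlate (r₀ r₁ γ C : ℝ) : Prop :=
  ∀ (ν T : ℝ) (u : ℝ → (EuclideanSpace ℝ (Fin 3)) → (EuclideanSpace ℝ (Fin 3)))
    (p : ℝ → (EuclideanSpace ℝ (Fin 3)) → ℝ), IsClassicalNSSolutionOn (Ico 0 T) ν 0 u p →
    ∀ t ∈ Ico 0 T, ∀ (x e : EuclideanSpace ℝ (Fin 3)) (M : ℝ), ‖e‖ = 1 → QFlatOn γ M r₁ u t x →
      |tfNearHess r₀ r₁ u t x e| ≤ C * M

/-- ★ PLATE T1 (PROVED): for `0 < r₀ < r₁`, `0 < γ` there is `C = A·3|B₁|·r₁^γ/γ + ⅓‖λ‖₁r₁^γ ≥ 0` with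
`|TF_ee(x)| ≤ C·M` whenever `q(t,·)` is `(γ,M)`-flat at `x` at scale `r₁`. -/
theorem exists_tfFlatnessPlate {r₀ r₁ γ : ℝ} (hr₀ : 0 < r₀) (hr₁ : r₀ < r₁) (hγ : 0 < γ) :
    ∃ C : ℝ, 0 ≤ C ∧ TFFlatnessPlate r₀ r₁ γ C := by
  obtain ⟨A, hA0, hA⟩ := exists_abs_newtonNearHess_le hr₀ hr₁
  have hr₁0 : 0 < r₁ := hr₀.trans hr₁
  have hL0 : 0 ≤ ∫ z, |newtonFarLaplacian r₀ r₁ z| := integral_nonneg fun z => abs_nonneg _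
  have hrg : 0 < r₁ ^ γ := Real.rpow_pos_of_pos hr₁0 γ
  refine ⟨A * (3 * (volume : Measure (EuclideanSpace ℝ (Fin 3))).real (ball 0 1)) * (r₁ ^ γ / γ) +
    1 / 3 * (∫ z, |newtonFarLaplacian r₀ r₁ z|) * r₁ ^ γ, by positivity, ?_⟩
  intro ν T u p hsol t ht x e M he hflat
  have hM : 0 ≤ M := hflat.nonneg hr₁0 he
  -- the Calderón–Zygmund part
  have hI₁ : ‖∫ y, newtonNearHess r₀ r₁ e e (x - y) * (qDensity u t y - qDensity u t x)‖ ≤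
      A * M * (3 * (volume : Measure (EuclideanSpace ℝ (Fin 3))).real (ball 0 1)) * (r₁ ^ γ / γ) := by
    refine norm_integral_le_of_indicator_ball (p := x) hγ hr₁0 (by positivity) fun y => ?_
    by_cases hy : y ∈ ball x r₁
    · rw [indicator_of_mem hy, ← ofReal_norm]
      refine ENNReal.ofReal_le_ofReal ?_
      rcases eq_or_ne y x with rfl | hne
      · simp only [sub_self, mul_zero, norm_zero]
        positivity
      · have hpos : 0 < ‖x - y‖ := norm_pos_iff.2 (sub_ne_zero.2 (Ne.symm hne))
        have hq := hflat y (ball_subset_closedBall hy)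
        rw [norm_mul, Real.norm_eq_abs, Real.norm_eq_abs]
        calc |newtonNearHess r₀ r₁ e e (x - y)| * |qDensity u t y - qDensity u t x|
            ≤ (A * ‖e‖ * ‖e‖ * ‖x - y‖ ^ (-(3 : ℝ))) * (M * ‖y - x‖ ^ γ) :=
              mul_le_mul (hA e e (x - y)) hq (abs_nonneg _) (by positivity)
          _ = A * M * ‖x - y‖ ^ (γ - 3) := by
              rw [he, norm_sub_rev y x, show γ - 3 = γ + (-(3 : ℝ)) by ring, Real.rpow_add hpos]
              ring
    · rw [indicator_of_notMem hy]
      have hxy : r₁ ≤ ‖x - y‖ := by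
        rw [norm_sub_rev]; exact not_lt.1 (fun h => hy (mem_ball_iff_norm.2 h))
      simp [newtonNearHess_eq_zero_of_le hr₀ hr₁ e e hxy]
  -- the shell part
  have hI₂ : ‖∫ z, newtonFarLaplacian r₀ r₁ z * (qDensity u t (x - z) - qDensity u t x)‖ ≤
      (∫ z, |newtonFarLaplacian r₀ r₁ z|) * (M * r₁ ^ γ) := by
    have hg : Integrable fun z => |newtonFarLaplacian r₀ r₁ z| * (M * r₁ ^ γ) :=
      (integrable_newtonFarLaplacian hr₀ hr₁).abs.mul_const _
    rw [← MeasureTheory.integral_mul_const]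
    refine norm_integral_le_of_norm_le hg (ae_of_all _ fun z => ?_)
    rw [norm_mul, Real.norm_eq_abs, Real.norm_eq_abs]
    by_cases hz : ‖z‖ ≤ r₁
    · refine mul_le_mul_of_nonneg_left ?_ (abs_nonneg _)
      have hmem : x - z ∈ closedBall x r₁ := by
        rw [mem_closedBall_iff_norm, sub_sub_cancel_left, norm_neg]; exact hz
      calc |qDensity u t (x - z) - qDensity u t x| ≤ M * ‖x - z - x‖ ^ γ := hflat _ hmem
        _ = M * ‖z‖ ^ γ := by rw [sub_sub_cancel_left, norm_neg]
        _ ≤ M * r₁ ^ γ := mul_le_mul_of_nonneg_left (Real.rpow_le_rpow (norm_nonneg _) hz hγ.le) hM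
    · rw [newtonFarLaplacian_eq_zero_of_gt hr₀.le hr₁ (lt_of_not_ge hz), abs_zero, zero_mul, zero_mul]
  rw [Real.norm_eq_abs] at hI₁ hI₂
  rw [tfNearHess_eq_integral_sub hsol ht hr₀ hr₁ x e]
  have h13 : |(1 : ℝ) / 3 * ∫ z, newtonFarLaplacian r₀ r₁ z * (qDensity u t (x - z) - qDensity u t x)| =
      1 / 3 * |∫ z, newtonFarLaplacian r₀ r₁ z * (qDensity u t (x - z) - qDensity u t x)| := by
    rw [abs_mul, abs_of_pos (by norm_num : (0 : ℝ) < 1 / 3)]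
  calc |(∫ y, newtonNearHess r₀ r₁ e e (x - y) * (qDensity u t y - qDensity u t x)) +
        1 / 3 * ∫ z, newtonFarLaplacian r₀ r₁ z * (qDensity u t (x - z) - qDensity u t x)|
      ≤ |∫ y, newtonNearHess r₀ r₁ e e (x - y) * (qDensity u t y - qDensity u t x)| +
        |1 / 3 * ∫ z, newtonFarLaplacian r₀ r₁ z * (qDensity u t (x - z) - qDensity u t x)| := abs_add_le _ _
    _ ≤ A * M * (3 * (volume : Measure (EuclideanSpace ℝ (Fin 3))).real (ball 0 1)) * (r₁ ^ γ / γ) +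
        1 / 3 * ((∫ z, |newtonFarLaplacian r₀ r₁ z|) * (M * r₁ ^ γ)) := by rw [h13]; linarith
    _ = (A * (3 * (volume : Measure (EuclideanSpace ℝ (Fin 3))).real (ball 0 1)) * (r₁ ^ γ / γ) +
        1 / 3 * (∫ z, |newtonFarLaplacian r₀ r₁ z|) * r₁ ^ γ) * M := by ring


/-! ## §17  DOOR D9 «QuadrupoleFlatnessDoor» — a singular-integral-free sufficient form of the D8′ hypothesis (★) -/

/-- DOOR D9 at fixed `(r₀, r₁, γ, C)`: on `[t₀,T)`, at every `δ`-almost strain maximiser above level `l₀`, `q` is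
`(γ,M)`-flat at scale `r₁` with `(⅓|S|² − λ_max²) + ((1/12)|ω|² − ¼ω_e²) + ⅓Λ_{r₀r₁}[q](x) + C·M ≤ 0`  ⟹  continuation. -/
def QuadrupoleFlatnessDoorAt (r₀ r₁ γ C : ℝ) : Prop :=
  ∀ (ν T t₀ l₀ δ : ℝ), 0 < ν → 0 ≤ t₀ → t₀ < T → 0 < l₀ → 0 < δ → δ < 1 →
    ∀ (u : ℝ → (EuclideanSpace ℝ (Fin 3)) → (EuclideanSpace ℝ (Fin 3)))
      (p : ℝ → (EuclideanSpace ℝ (Fin 3)) → ℝ),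
      IsClassicalNSSolutionOn (Ico 0 T) ν 0 u p →
      (∀ T'' < T, HasBoundedSobolevNormsOn (Icc 0 T'') u) →
      (∀ t ∈ Ico t₀ T, ∀ (x e : EuclideanSpace ℝ (Fin 3)), IsStrainAlmostArgmax δ u t x e → l₀ < strainQuad u t x e →
        ∃ M : ℝ, QFlatOn γ M r₁ u t x ∧
          ((1 / 3) * strainNormSq u t x - strainQuad u t x e ^ 2) +
            ((1 / 12) * ‖curl (u t) x‖ ^ 2 - (1 / 4) * ⟪curl (u t) x, e⟫ ^ 2) +
            (1 / 3) * shellAverage r₀ r₁ u t x + C * M ≤ 0) →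
      HasSobolevExtensionPast ν u T

/-- DOOR D9 «QuadrupoleFlatnessDoor»: for all admissible `(r₀, r₁, γ)` SOME constant `C ≥ 0` opens the door. -/
def QuadrupoleFlatnessDoor : Prop :=
  ∀ (r₀ r₁ γ : ℝ), 0 < r₀ → r₀ < r₁ → 0 < γ → ∃ C : ℝ, 0 ≤ C ∧ QuadrupoleFlatnessDoorAt r₀ r₁ γ C

/-- D8′ + a valid plate constant ⟹ D9 at that constant. -/
theorem quadrupoleFlatnessDoorAt_of_plate (h8 : FineStructureParityDoor) {r₀ r₁ γ C : ℝ} (hr₀ : 0 < r₀) (hr₁ : r₀ < r₁)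
    (hC : TFFlatnessPlate r₀ r₁ γ C) : QuadrupoleFlatnessDoorAt r₀ r₁ γ C := by
  intro ν T t₀ l₀ δ hν ht₀ hT hl₀ hδ hδ1 u p hsol hSob hhyp
  refine h8 ν T t₀ l₀ δ r₀ r₁ hν ht₀ hT hl₀ hδ hδ1 hr₀ hr₁ u p hsol hSob fun t ht x e hx hl => ?_
  obtain ⟨M, hflat, hineq⟩ := hhyp t ht x e hx hl
  have hTF : |tfNearHess r₀ r₁ u t x e| ≤ C * M := hC ν T u p hsol t ⟨ht₀.trans ht.1, ht.2⟩ x e M hx.1 hflat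
  have hle := neg_abs_le (tfNearHess r₀ r₁ u t x e)
  linarith

/-- larger constants give weaker doors. -/
theorem quadrupoleFlatnessDoorAt_mono {r₀ r₁ γ C C' : ℝ} (hr₁ : 0 < r₁) (hCC' : C ≤ C')
    (h : QuadrupoleFlatnessDoorAt r₀ r₁ γ C) : QuadrupoleFlatnessDoorAt r₀ r₁ γ C' := by
  intro ν T t₀ l₀ δ hν ht₀ hT hl₀ hδ hδ1 u p hsol hSob hhyp
  refine h ν T t₀ l₀ δ hν ht₀ hT hl₀ hδ hδ1 u p hsol hSob fun t ht x e hx hl => ?_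
  obtain ⟨M, hflat, hineq⟩ := hhyp t ht x e hx hl
  have hM : 0 ≤ M := hflat.nonneg hr₁ hx.1
  exact ⟨M, hflat, by nlinarith [mul_le_mul_of_nonneg_right hCC' hM]⟩

/-- ★ D8′ ⟹ D9. -/
theorem quadrupoleFlatnessDoor_of_D8' (h8 : FineStructureParityDoor) : QuadrupoleFlatnessDoor := by
  intro r₀ r₁ γ hr₀ hr₁ hγ
  obtain ⟨C, hC0, hC⟩ := exists_tfFlatnessPlate hr₀ hr₁ hγ
  exact ⟨C, hC0, quadrupoleFlatnessDoorAt_of_plate h8 hr₀ hr₁ hC⟩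

/-- ★★ D9 from the single NS-free atom B3. -/
theorem quadrupoleFlatnessDoor_of_B3 (h3 : HessSmoothingEnergyBound) : QuadrupoleFlatnessDoor :=
  quadrupoleFlatnessDoor_of_D8' (fineStructureParityDoor_of_B3 h3)

end Summit.NavierStokesRegularity.NavierStokesRegularity.Theorems.StrainDoors
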